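import Summits.BirchSwinnertonDyer.BirchSwinnertonDyer.Theorems.ByReductionTypeAtTwoTorsionEulerCharTransport
import Summits.BirchSwinnertonDyer.BirchSwinnertonDyer.Theorems.ByReductionTypeAtTwoTorsionEulerCharCasselsGe
import HarnessLib

set_option linter.dupNamespace false -- `…BirchSwinnertonDyer.BirchSwinnertonDyer…` is the cell's nested layout (D-0017)
set_option autoImplicit false

/-!
# Greenberg LNM 1716 Lemma 4.7 WITH RATIONAL `p`-TORSION, part 15: the displayed hypothesis `H46` (Lemma 4.6 on `Γ`-invariants
# above `v₀`) HOLDS on the image of the receptacle, hence OUTRIGHT when `E(K)[p] = 0` — consistency of the `H46` currency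

Cell `bsd-2adic` (run/shared/lean/pub/bsd-2adic/), seat `bsd-2adic-tower-1` GEN 32; `--supports stmt-BirchSwinnertonDyer-19271`
(helper). THEOREMS ONLY (no definition, no named fact, no `sorry`); closes no item; nothing booked; BSD is not proved by any of this.

R. Greenberg, *Iwasawa theory for elliptic curves*, LNM 1716 (1999), §4 Lemma 4.6 (p. 105), Lemma 4.7 (p. 108: «It is also
clear that Im(a) is mapped … to Im(b)»), Prop. 4.13 (p. 122). Parts 9/12–14 isolate ONE displayed hypothesis

  `H46(W, p, κ, v₀)`: every class `z ∈ H¹(Γ_{K_{v₀}}|_⊤, E)` killed by a power of `p` is `loc_{v₀}(conj_σ T)` (all `σ ∈ Γ_K`)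
  for some `T ∈ H¹(Gal(K̄/K_∞), E[p^∞])` with local class `0` at every `v ≠ v₀` and at `∞`.

This file records two checks on that currency, for ANY number field `K`, prime `p` and `ℤ_p`-extension `κ`:

* `exists_realizer_of_mem_map` — `H46` holds for every `z` in the image `loc_{v₀}(U)` of the receptacle `U ≤ H¹(Γ_K, E[p^∞])`
  (classes unramified outside `S ∪ {v₀}` with local class `0` on `S` and at `∞`): `T := res u` (part 7 `resOfLe_top_realizes`,
  part 8 `mem_receptacleClasses_iff`) — Greenberg's «Im(a) ↦ Im(b)»;
* `exists_realizer_of_natCard_primaryComponent_eq_one` — if `#E(K)[p^∞] = 1` and `Sel_{p^∞}(E/K)` is finite, `H46(W, p, κ, v₀)`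
  holds OUTRIGHT at every good `v₀ ∉ S` (Cassels at `v₀`, part 11 `natCard_cokernel_eq`: the cokernel `C_{v₀}` is trivial, so
  every `p`-primary `z` lies in `loc_{v₀}(U)`).

So `H46` carries content exactly on the `#E(K)[p^∞] − 1` non-trivial cosets of `C_{v₀}`; with part 13
(`twoAdicEulerCharRankZero_of_lemma46_at`) the second theorem recovers GEN 25's no-`2`-torsion display
`GreenbergEulerChar.twoAdicEulerCharRankZero_of_noTwoTorsion` through the torsion road (consistency check, not a new result).

HONEST FRAMING: `H46` in general (rational `p`-torsion present) is NOT proved here. Kernel-checked over tree theorems; closes no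
item; no summit statement is proved; the Birch–Swinnerton-Dyer conjecture is NOT proved by any of this.

References: [GreenbergLNM1716] §4 Lemma 4.6 (p. 105), Lemma 4.7 (p. 108), Prop. 4.13 (p. 122).
-/

noncomputable section

open scoped Classical NumberField

open NumberField IsDedekindDomain Field

namespace Summit.BirchSwinnertonDyer.BirchSwinnertonDyer.Theorems.TorsionEulerChar

open Literature.NumberTheory.EllipticCurves Literature.NumberTheory.GaloisRepresentations
  WeierstrassCurve ZpExtension Literature.NumberTheory.EllipticCurves.IwasawaAlgebra
  Literature.NumberTheory.EllipticCurves.IwasawaDual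
  Literature.NumberTheory.EllipticCurves.GreenbergVatsal2000 Literature.NumberTheory.EllipticCurves.GreenbergSelmer

variable {K : Type} [Field K] [NumberField K] (W : WeierstrassCurve K) [W.IsElliptic] (p : ℕ) [hp : Fact p.Prime]
  (κ : ZpExtension K p)

/-! ## §1 `H46` on the image of the receptacle -/

/-- **`H46` holds on `loc_{v₀}(U)`** («Im(a) ↦ Im(b)», Greenberg p. 108): if `z = loc_{v₀} u` for a class `u ∈ H¹(Γ_K, E[p^∞])`
unramified outside `S ∪ {v₀}` with local class `0` on `S` and at `∞` (`S ⊇ {bad} ∪ {v ∣ p}`, `v₀ ∉ S`), then `T := res_{K_∞} u`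
realises `z`: `conj_σ T = T` is Selmer at every place `≠ v₀` and at `∞`, and `loc_{v₀}(conj_σ T) = res z` for every `σ`
(part 8 `mem_receptacleClasses_iff`: «unramified = local class 0» at the good places; part 7 `resOfLe_top_realizes`).
[cite: GreenbergLNM1716, §4 Lemma 4.7 (p. 108)] -/
theorem exists_realizer_of_mem_map (S : Finset (HeightOneSpectrum (𝓞 K)))
    (hS : ∀ v ∉ S, ((p : ℕ) : 𝓞 K) ∉ v.asIdeal ∧ W.HasGoodReductionAt v)
    (v₀ : HeightOneSpectrum (𝓞 K)) (hv₀ : v₀ ∉ S)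
    (z : discreteH1 (localSubgroup (⊤ : Subgroup (absoluteGaloisGroup K)) (v₀.adicCompletion K))
      (localPoints W (v₀.adicCompletion K)))
    (hz : z ∈ AddSubgroup.map (W.localResOver p ⊤ (v₀.adicCompletion K))
      (unramifiedOutside (⊤ : Subgroup (absoluteGaloisGroup K)) (W.geomPrimaryTorsion p) p
          ((↑S : Set (HeightOneSpectrum (𝓞 K))) ∪ {v₀}) ⊓
        (⨅ v ∈ S, W.localKerOver p ⊤ (v.adicCompletion K)) ⊓
        (⨅ w : InfinitePlace K, W.localKerOver p ⊤ w.Completion))) :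
    ∃ T : W.subgroupH1 p κ.kerSubgroup,
      (∀ v : HeightOneSpectrum (𝓞 K), v ≠ v₀ → ∀ σ : absoluteGaloisGroup K,
        W.conjH1 p κ.kerSubgroup σ T ∈ W.localKerOver p κ.kerSubgroup (v.adicCompletion K)) ∧
      (∀ (w : InfinitePlace K) (σ : absoluteGaloisGroup K),
        W.conjH1 p κ.kerSubgroup σ T ∈ W.localKerOver p κ.kerSubgroup w.Completion) ∧
      ∀ σ : absoluteGaloisGroup K,
        W.localResOver p κ.kerSubgroup (v₀.adicCompletion K) (W.conjH1 p κ.kerSubgroup σ T) =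
          Literature.NumberTheory.EllipticCurves.resOfLe (localPoints W (v₀.adicCompletion K))
            (Subgroup.comap_mono le_top :
              localSubgroup κ.kerSubgroup (v₀.adicCompletion K) ≤
                localSubgroup (⊤ : Subgroup (absoluteGaloisGroup K)) (v₀.adicCompletion K)) z := by
  obtain ⟨u, hu, rfl⟩ := hz
  obtain ⟨hfin, hinf⟩ := (mem_receptacleClasses_iff W p S hS v₀ hv₀ u).mp hu
  obtain ⟨-, hTv, hTw, hT0⟩ := resOfLe_top_realizes W p κ v₀ u
    (fun v hv ↦ (W.mem_localKerOver_iff p ⊤ _ u).mpr (hfin v hv))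
    (fun w ↦ (W.mem_localKerOver_iff p ⊤ _ u).mpr (hinf w))
  exact ⟨W.resOfLe p (le_top : κ.kerSubgroup ≤ ⊤) u, hTv, hTw, hT0⟩

/-! ## §2 `H46` outright when `E(K)[p] = 0` -/

/-- **`H46(W, p, κ, v₀)` holds when `#E(K)[p^∞] = 1`** (`Sel_{p^∞}(E/K)` finite, `S ⊇ {bad} ∪ {v ∣ p}`, `v₀ ∉ S`, any `ℤ_p`-extension
`κ`): by Cassels' theorem at `v₀` (part 11 `natCard_cokernel_eq`) the cokernel `H¹(Γ_{K_{v₀}}, E)(p) / loc_{v₀}(U)` is trivial, so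
every `p`-primary `z` lies in `loc_{v₀}(U)` and §1 applies. With part 13 this recovers the no-torsion display of GEN 25 through
the torsion road (consistency check). [cite: GreenbergLNM1716, §4 p. 104, Lemma 4.6 (p. 105), Prop. 4.13 (p. 122)] -/
theorem exists_realizer_of_natCard_primaryComponent_eq_one [Finite (W.selmerGroupPInfty p)]
    (hE : Nat.card (AddCommGroup.primaryComponent W.toAffine.Point p) = 1)
    (S : Finset (HeightOneSpectrum (𝓞 K)))
    (hS : ∀ v ∉ S, ((p : ℕ) : 𝓞 K) ∉ v.asIdeal ∧ W.HasGoodReductionAt v)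
    (v₀ : HeightOneSpectrum (𝓞 K)) (hv₀ : v₀ ∉ S)
    (z : discreteH1 (localSubgroup (⊤ : Subgroup (absoluteGaloisGroup K)) (v₀.adicCompletion K))
      (localPoints W (v₀.adicCompletion K)))
    (hz : ∃ k : ℕ, p ^ k • z = 0) :
    ∃ T : W.subgroupH1 p κ.kerSubgroup,
      (∀ v : HeightOneSpectrum (𝓞 K), v ≠ v₀ → ∀ σ : absoluteGaloisGroup K,
        W.conjH1 p κ.kerSubgroup σ T ∈ W.localKerOver p κ.kerSubgroup (v.adicCompletion K)) ∧
      (∀ (w : InfinitePlace K) (σ : absoluteGaloisGroup K),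
        W.conjH1 p κ.kerSubgroup σ T ∈ W.localKerOver p κ.kerSubgroup w.Completion) ∧
      ∀ σ : absoluteGaloisGroup K,
        W.localResOver p κ.kerSubgroup (v₀.adicCompletion K) (W.conjH1 p κ.kerSubgroup σ T) =
          Literature.NumberTheory.EllipticCurves.resOfLe (localPoints W (v₀.adicCompletion K))
            (Subgroup.comap_mono le_top :
              localSubgroup κ.kerSubgroup (v₀.adicCompletion K) ≤
                localSubgroup (⊤ : Subgroup (absoluteGaloisGroup K)) (v₀.adicCompletion K)) z := by
  classical
  -- notation: `P₀ = H¹(Γ_{K_{v₀}}, E)(p)`, `L = loc_{v₀}(U)`, `C = P₀ / (L ∩ P₀)`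
  let Pv := discreteH1 (localSubgroup (⊤ : Subgroup (absoluteGaloisGroup K)) (v₀.adicCompletion K))
    (localPoints W (v₀.adicCompletion K))
  let P₀ : AddSubgroup Pv := AddCommGroup.primaryComponent Pv p
  let L : AddSubgroup Pv := AddSubgroup.map (W.localResOver p ⊤ (v₀.adicCompletion K))
    (unramifiedOutside (⊤ : Subgroup (absoluteGaloisGroup K)) (W.geomPrimaryTorsion p) p
        ((↑S : Set (HeightOneSpectrum (𝓞 K))) ∪ {v₀}) ⊓
      (⨅ v ∈ S, W.localKerOver p ⊤ (v.adicCompletion K)) ⊓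
      (⨅ w : InfinitePlace K, W.localKerOver p ⊤ w.Completion))
  -- Cassels at `v₀`: `#C = #E(K)(p) = 1`, so `C` is trivial
  haveI hfin : Finite (P₀ ⧸ L.addSubgroupOf P₀) := (finite_and_natCard_cokernel_le W p S hS v₀ hv₀).1
  have hcard : Nat.card (P₀ ⧸ L.addSubgroupOf P₀) = 1 := by
    have h := natCard_cokernel_eq W p S hS v₀ hv₀
    rw [hE] at h
    exact h
  haveI : Subsingleton (P₀ ⧸ L.addSubgroupOf P₀) := Nat.card_eq_one_iff_unique.mp hcard |>.1
  -- `z ∈ P₀`, hence `z ∈ L`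
  have hzP : z ∈ P₀ := (AddCommGroup.mem_primaryComponent).mpr hz
  have hzL : z ∈ L := by
    have h0 : (QuotientAddGroup.mk (⟨z, hzP⟩ : P₀) : P₀ ⧸ L.addSubgroupOf P₀) = 0 := Subsingleton.elim _ _
    rw [QuotientAddGroup.eq_zero_iff, AddSubgroup.mem_addSubgroupOf] at h0
    exact h0
  exact exists_realizer_of_mem_map W p κ S hS v₀ hv₀ z hzL

end Summit.BirchSwinnertonDyer.BirchSwinnertonDyer.Theorems.TorsionEulerChar

end
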